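import Summits.HodgeConjecture.HodgeConjecture.Theorems.Q8SymplecticPowersEndBound
import Summits.HodgeConjecture.HodgeConjecture.Theorems.Q8SymplecticPowersGraphCorrespondences
import Summits.HodgeConjecture.HodgeConjecture.Theorems.Q8SymplecticPowersEndomorphismAlgebra
import Literature.AlgebraicGeometry.HodgeTheory.BettiHodgeConjectureSurfaceSquareGenericEndomorphisms
import Literature.AlgebraicGeometry.HodgeTheory.ClassesSupportedOnComplexification
import Literature.AlgebraicGeometry.Motives.FibrePowerFan
import Literature.AlgebraicGeometry.HodgeTheory.DominatedByPowersHodgeConjecture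
import Literature.AlgebraicGeometry.HodgeTheory.LefschetzOneOneHolds
import HarnessLib

/-!
# Route `Q8SymplecticPowers`, programme K2Q — brick S2 (assembly): **`HC(X × X)` for a surface with the route's
# quaternionic deck data and `Comm` clause**

Support file for crux K2Q `PowersHodgeOfQuaternionCommutators` (stmt-HodgeConjecture-24191; `--supports … --as helper`;
nothing here closes an item).  Prover seat `hodge-nonav-20241-p1` (g20).

**`hodgeConjectureFor_tensor_self`**: for a smooth projective surface `X` with `τ, j : X ⟶ X` satisfying the route's deck
clause (`τ^{*4} = 1`, `j^{*2} = τ^{*2}`, `j^*τ^* = τ^{*3}j^*`, no `τ^{*2}`-invariant and some anti-invariant `(2,0)`-form) and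
`Comm` clause, the Hodge conjecture holds for `X ⊗ X`.  The argument is the tree's `ρ² + 1` criterion
(`BettiUniverse.hodgeConjectureFor_tensor_self_of_finrank_end_le`, Voisin I Lemma 11.41 / 2025 Cor. 3.9) with THREE MORE
correspondences: the Hodge classes of `H²X ⊗ H²X` number `dim End_HS(H²X) ≤ ρ² + 4` (END-BOUND, brick S1), and
`NS ⊗ NS ⊕ ℚ t_𝟙 ⊕ ℚ t_τ ⊕ ℚ t_j ⊕ ℚ t_{τj}` — `t_σ` the `(2,2)`-Künneth component of the graph class of `σ` (brick S2-G), all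
with algebraic cross products — has dimension `ρ² + 4`: a relation `p + Σ c_σ t_σ = 0` acts on `T ⊗ 1` (`T` the transcendental
part, killed into `NS ⊗ ℂ` by `p ∈ NS ⊗ NS`) as `Σ c_σ σ^* ∈ NS ∩ T = 0`, and `1, τ^*, j^*, τ^*j^*` are `ℚ`-independent on
`T ≠ 0` (quaternion relations, bricks C-Q3).  Companions: `powersHodge_le_one` — the conclusion of the registered stub
`stub_squareQ` (`k ≤ 1`) — and §4 **`stub_squareQ` itself, by name and registered signature**.  HONEST FRAMING: axioms standard; item 24191 OPEN until the stub lands by name; nothing here says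
HC ∕ HC_CM ∕ HC_AV is proved.

## References

* C. Voisin, *Hodge Theory and Complex Algebraic Geometry I* (2002), §11.3.3 Thm. 11.38–11.40, Lemma 11.41, pp. 286–287.
  [cite: VoisinHodgeI2002]
* C. Voisin, *Hodge structures and the topology of algebraic varieties* (2025), §3.2.1 Prop. 3.8, Cor. 3.9. [cite: Voisin2025]
* W. Fulton, *Intersection Theory* (1998), §16.1. [cite: Fulton1998]
-/

set_option linter.dupNamespace false

noncomputable section

open scoped TensorProduct
open CategoryTheory CategoryTheory.Limits MonoidalCategory CartesianMonoidalCategory Module Finset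
open Literature.AlgebraicTopology.SingularHomology
open Literature.AlgebraicGeometry.Motives Literature.AlgebraicGeometry.HodgeTheory
open Literature.AlgebraicGeometry.HodgeTheory.BettiUniverse
open Literature.AlgebraicGeometry.Motives.HodgeStructure
open Summit.HodgeConjecture.HodgeConjecture.Theorems.Q8SymplecticPowersTranscendentalPart
open Summit.HodgeConjecture.HodgeConjecture.Theorems.Q8SymplecticPowersEndBound
open Summit.HodgeConjecture.HodgeConjecture.Theorems.Q8SymplecticPowersGraphCorrespondences

namespace Summit.HodgeConjecture.HodgeConjecture.Theorems.Q8SymplecticPowersSquare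

variable {X : SchemeOver ℂ}

/-! ### §1 Rational bookkeeping -/

/-- `ofRatClass` is `ℚ`-homogeneous. [folklore] -/
private theorem ofRatClass_rat_smul {Y : Type} [TopologicalSpace Y] {k : ℕ} (q : ℚ) (a : singularCohomology ℚ ℚ Y k) :
    ofRatClass Y k (q • a) = (q : ℂ) • ofRatClass Y k a := by
  rw [Literature.AlgebraicGeometry.Motives.ofRatClass_smul]

/-- `(σ^* v) ⊗ 1 = σ^* (v ⊗ 1)`. [cite: HatcherAT2002, §3.1 p. 198] -/
theorem ofRatClass_pull {Y Z : SchemeOver ℂ} (f : Y ⟶ Z) (k : ℕ) (v : bettiCohomology Z k) :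
    ofRatClass (ComplexPoints Y) k (pull f k v) = (complexBetti.map f k).hom (ofRatClass (ComplexPoints Z) k v) :=
  Literature.AlgebraicGeometry.Motives.ofRatClass_map k (AlgPoints.mapContinuous (L := ℂ) f) v

/-- **Rational descent along `v ↦ v ⊗ 1`**: a rational class whose complexification lies in the `ℂ`-span of `N ⊗ 1`, `N` a
`ℚ`-subspace, lies in `N` (apply `λ ⊗ id` for a `ℚ`-linear retraction `λ : ℂ → ℚ` of `1`). [folklore] -/
theorem mem_of_ofRatClass_mem_span {n k : ℕ} (hX : IsSmoothProjective n X) (N : Submodule ℚ (bettiCohomology X k))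
    {y : bettiCohomology X k}
    (hy : ofRatClass (ComplexPoints X) k y ∈ Submodule.span ℂ (ofRatClass (ComplexPoints X) k '' (N : Set (bettiCohomology X k)))) :
    y ∈ N := by
  obtain ⟨l, hl⟩ := Q8SymplecticPowersEndomorphismAlgebra.exists_ratLinear_retraction
  let e := ofRatClassBaseChangeEquiv hX k
  let Λ : ℂ ⊗[ℚ] bettiCohomology X k →ₗ[ℚ] bettiCohomology X k := TensorProduct.lift ((LinearMap.lsmul ℚ _).comp l)
  have hΛ : ∀ (c : ℂ) (v : bettiCohomology X k), Λ (c ⊗ₜ v) = l c • v := fun c v => by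
    simp only [Λ, TensorProduct.lift.tmul, LinearMap.comp_apply, LinearMap.lsmul_apply]
  have he : ∀ v : bettiCohomology X k, e ((1 : ℂ) ⊗ₜ v) = ofRatClass (ComplexPoints X) k v := fun v => by
    rw [show e ((1 : ℂ) ⊗ₜ v) = ofRatClassBaseChange (ComplexPoints X) k ((1 : ℂ) ⊗ₜ v) from rfl,
      ofRatClassBaseChange_tmul, one_smul]
  have key : ∀ u ∈ Submodule.span ℂ (ofRatClass (ComplexPoints X) k '' (N : Set (bettiCohomology X k))),
      ∀ c : ℂ, Λ (e.symm (c • u)) ∈ N := by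
    intro u hu
    refine Submodule.span_induction ?_ ?_ ?_ ?_ hu
    · rintro _ ⟨v, hv, rfl⟩ c
      rw [← he, ← map_smul, LinearEquiv.symm_apply_apply, TensorProduct.smul_tmul', smul_eq_mul, mul_one, hΛ]
      exact N.smul_mem _ hv
    · intro c
      rw [smul_zero, map_zero, map_zero]
      exact N.zero_mem
    · intro u v _ _ hu hv c
      rw [smul_add, map_add, map_add]
      exact N.add_mem (hu c) (hv c)
    · intro d u _ hu c
      rw [smul_smul]
      exact hu (c * d)
  have h1 := key _ hy 1
  rwa [one_smul, ← he, LinearEquiv.symm_apply_apply, hΛ, hl, one_smul] at h1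

/-! ### §2 `1, τ^*, j^*, τ^* j^*` are `ℚ`-independent on the transcendental part -/

/-- If `c · a = d` pointwise on a non-zero subspace `T` stable under `a` with `a² = -1` on `T`, then `c = d = 0`. [folklore] -/
theorem eq_zero_of_smul_a_eq {V : Type*} [AddCommGroup V] [Module ℚ V] (T : Submodule ℚ V) (hT : T ≠ ⊥) (a : V →ₗ[ℚ] V)
    (haT : ∀ x ∈ T, a x ∈ T) (haa : ∀ x ∈ T, a (a x) = -x) (c d : ℚ) (h : ∀ x ∈ T, c • a x = d • x) :
    c = 0 ∧ d = 0 := by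
  obtain ⟨x, hx, hx0⟩ := Submodule.exists_mem_ne_zero_of_ne_bot hT
  have h1 := h x hx
  have h2 := h (a x) (haT x hx)
  rw [haa x hx, smul_neg] at h2
  -- `d² x = d c a x = c (d • a x) = -c² x`
  have h3 : (c * c + d * d) • x = 0 := by
    have e1 : (d * c) • a x = (d * d) • x := by rw [mul_smul, h1, smul_smul]
    have e2 : (c * d) • a x = -((c * c) • x) := by rw [mul_smul, ← h2, smul_neg, smul_smul]
    rw [mul_comm d c] at e1
    rw [add_smul, ← e1, e2, add_neg_cancel]
  have hcd : c * c + d * d = 0 := by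
    rcases smul_eq_zero.1 h3 with h | h
    · exact h
    · exact absurd h hx0
  constructor <;> nlinarith [sq_nonneg c, sq_nonneg d]

/-- **`ℚ`-independence of `1, a, b, ab` on a non-zero `T`** with `a² = b² = -1`, `ab = -ba` on `T` (a module over the Hamilton
quaternions): `c₀ x + c₁ a x + c₂ b x + c₃ a b x = 0` on `T` forces `c = 0`. [folklore] -/
theorem quaternion_coeffs_eq_zero {V : Type*} [AddCommGroup V] [Module ℚ V] (T : Submodule ℚ V) (hT : T ≠ ⊥) (a b : V →ₗ[ℚ] V)
    (haT : ∀ x ∈ T, a x ∈ T) (hbT : ∀ x ∈ T, b x ∈ T) (haa : ∀ x ∈ T, a (a x) = -x) (hbb : ∀ x ∈ T, b (b x) = -x)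
    (hab : ∀ x ∈ T, a (b x) = -b (a x)) (c₀ c₁ c₂ c₃ : ℚ)
    (h : ∀ x ∈ T, c₀ • x + c₁ • a x + c₂ • b x + c₃ • a (b x) = 0) : c₀ = 0 ∧ c₁ = 0 ∧ c₂ = 0 ∧ c₃ = 0 := by
  -- (E1) = the relation at `a x`, (E2) = `a` applied to the relation at `x`
  have hF : ∀ x ∈ T, c₀ • a x = c₁ • x ∧ c₂ • a (b x) = c₃ • b x := by
    intro x hx
    have E1 := h (a x) (haT x hx)
    have hbax : b (a x) = -a (b x) := by rw [hab x hx, neg_neg]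
    rw [haa x hx, hbax, map_neg, haa _ (hbT x hx)] at E1
    -- E1 : c₀ • a x + c₁ • -x + c₂ • -a (b x) + c₃ • -(-b x) ... normalised below
    have E2 := congr_arg a (h x hx)
    rw [map_zero, map_add, map_add, map_add, map_smul, map_smul, map_smul, map_smul, haa x hx, haa _ (hbT x hx)] at E2
    constructor
    · -- (E1) + (E2)
      have hsum : (2 : ℚ) • (c₀ • a x) = (2 : ℚ) • (c₁ • x) := by
        rw [two_smul, two_smul]
        have := congr_arg₂ (· + ·) E1 E2
        simp only [add_zero, smul_neg, neg_neg] at this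
        -- this : (c₀•ax + -(c₁•x) + -(c₂•a(bx)) + c₃•bx) + (c₀•ax + -(c₁•x) + c₂•a(bx) + -(c₃•bx)) = 0
        have h' : c₀ • a x + c₀ • a x - (c₁ • x + c₁ • x) = 0 := by
          rw [← this]; abel
        exact (sub_eq_zero.1 h')
      exact smul_right_injective _ (by norm_num : (2 : ℚ) ≠ 0) hsum
    · -- (E2) - (E1)
      have hdiff : (2 : ℚ) • (c₂ • a (b x)) = (2 : ℚ) • (c₃ • b x) := by
        rw [two_smul, two_smul]
        have := congr_arg₂ (· - ·) E2 E1
        simp only [sub_zero, smul_neg, neg_neg] at this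
        have h' : c₂ • a (b x) + c₂ • a (b x) - (c₃ • b x + c₃ • b x) = 0 := by
          rw [← this]; abel
        exact (sub_eq_zero.1 h')
      exact smul_right_injective _ (by norm_num : (2 : ℚ) ≠ 0) hdiff
  obtain ⟨h₀, h₁⟩ := eq_zero_of_smul_a_eq T hT a haT haa c₀ c₁ fun x hx => (hF x hx).1
  -- `c₂ • a y = c₃ • y` on `T` (take `x = b y`)
  obtain ⟨h₂, h₃⟩ := eq_zero_of_smul_a_eq T hT a haT haa c₂ c₃ fun y hy => by
    have e := (hF (b y) (hbT y hy)).2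
    rw [hbb y hy, map_neg, smul_neg, smul_neg, neg_inj] at e
    exact e
  exact ⟨h₀, h₁, h₂, h₃⟩

/-! ### §3 `HC(X ⊗ X)` -/

/-- **`HC(X × X)` for a smooth projective surface carrying the route's quaternionic deck data and satisfying its `Comm`
clause.** [cite: VoisinHodgeI2002, §11.3.3 Thm. 11.38–11.40, Lemma 11.41 and pp. 286–287] [cite: Voisin2025, §3.2.1 Prop. 3.8 and Cor. 3.9]
[cite: Fulton1998, §16.1 Prop. 16.1.1] -/
theorem hodgeConjectureFor_tensor_self (hX : IsSmoothProjective 2 X) (τ j : X ⟶ X) (h4 : pull τ 2 ^ 4 = 1)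
    (hj : pull j 2 ^ 2 = pull τ 2 ^ 2) (hrel : pull j 2 * pull τ 2 = pull τ 2 ^ 3 * pull j 2)
    (h20 : Module.finrank ℂ ↥(Module.End.eigenspace ((pull τ 2 ^ 2).baseChange ℂ) 1 ⊓
      (hodge exists_isReal_hodgeModel_holds hX 2).piece 2 0) = 0)
    (hpos : 0 < Module.finrank ℂ ↥(Module.End.eigenspace ((pull τ 2 ^ 2).baseChange ℂ) (-1) ⊓
      (hodge exists_isReal_hodgeModel_holds hX 2).piece 2 0))
    (hComm : haveI := finite hX 2; haveI : HodgeTensorFacts.{0, 0} := hodgeTensorFacts_holds;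
      ∀ g h : bettiCohomology X 2 ≃ₗ[ℚ] bettiCohomology X 2,
        ((∀ x, g (pull τ 2 x) = pull τ 2 (g x)) ∧ (∀ x, g (pull j 2 x) = pull j 2 (g x)) ∧
          (∀ x y, tr hX (2 + 2) (cup X 2 2 (g x) (g y)) = tr hX (2 + 2) (cup X 2 2 x y)) ∧
          ∀ x ∈ (hodge exists_isReal_hodgeModel_holds hX 2).hodgeClasses 1, g x = x) →
        ((∀ x, h (pull τ 2 x) = pull τ 2 (h x)) ∧ (∀ x, h (pull j 2 x) = pull j 2 (h x)) ∧
          (∀ x y, tr hX (2 + 2) (cup X 2 2 (h x) (h y)) = tr hX (2 + 2) (cup X 2 2 x y)) ∧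
          ∀ x ∈ (hodge exists_isReal_hodgeModel_holds hX 2).hodgeClasses 1, h x = x) →
        g * h * g⁻¹ * h⁻¹ ∈ (hodge exists_isReal_hodgeModel_holds hX 2).hodgeGroup) :
    HodgeConjectureFor 4 (X ⊗ X) := by
  classical
  haveI : HodgeTensorFacts.{0, 0} := hodgeTensorFacts_holds
  haveI := finite hX 2
  have hXX : IsSmoothProjective 4 (X ⊗ X) := hX.tensor_holds hX
  have h11 : (1 : ℤ) + 1 = ((2 : ℕ) : ℤ) := by norm_num
  obtain ⟨ψ⟩ := hodge_isPolarizable exists_isReal_hodgeModel_holds hX 2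
  have hc : IsCompl ((hodge exists_isReal_hodgeModel_holds hX 2).hodgeClasses 1)
      (ψ.form.orthogonal ((hodge exists_isReal_hodgeModel_holds hX 2).hodgeClasses 1)) :=
    ψ.isCompl_hodgeClasses_orthogonal h11
  have hpg : (hodge exists_isReal_hodgeModel_holds hX 2).piece 2 0 ≠ ⊥ := by
    intro hbot
    rw [hbot, inf_bot_eq, finrank_bot] at hpos
    exact lt_irrefl _ hpos
  have hTne := transcendental_ne_bot hX ψ hpg
  obtain ⟨hτ2, hj2, hτj⟩ := quaternion_relations_on_transcendental hX ψ τ j h4 hj hrel h20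
  -- END-BOUND
  have hEnd := finrank_end_hodge_le hX τ j h4 hj hrel h20 hpos hComm
  -- the four correspondences
  obtain ⟨t₀, ht₀, halg₀, hact₀⟩ := exists_kunneth_two_two_algebraic_corrAction_eq_map hX (𝟙 X)
  obtain ⟨t₁, ht₁, halg₁, hact₁⟩ := exists_kunneth_two_two_algebraic_corrAction_eq_map hX τ
  obtain ⟨t₂, ht₂, halg₂, hact₂⟩ := exists_kunneth_two_two_algebraic_corrAction_eq_map hX j
  obtain ⟨t₃, ht₃, halg₃, hact₃⟩ := exists_kunneth_two_two_algebraic_corrAction_eq_map hX (τ ≫ j)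
  refine hodgeConjectureFor_tensor_surfaces_of_kunneth_piece_two_two exists_isReal_hodgeModel_holds hX hX hXX fun t ht ↦ ?_
  set NS := (hodge exists_isReal_hodgeModel_holds hX 2).hodgeClasses 1 with hNS
  set P₀ : Submodule ℚ (bettiCohomology X 2 ⊗[ℚ] bettiCohomology X 2) := LinearMap.range (TensorProduct.mapIncl NS NS)
    with hP₀
  let tt : Fin 4 → bettiCohomology X 2 ⊗[ℚ] bettiCohomology X 2 := ![t₀, t₁, t₂, t₃]
  set Q : Submodule ℚ (bettiCohomology X 2 ⊗[ℚ] bettiCohomology X 2) := Submodule.span ℚ (Set.range tt) with hQ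
  -- Hodge classes
  have hP₀le : P₀ ≤ ((hodge exists_isReal_hodgeModel_holds hX 2).tensor (hodge exists_isReal_hodgeModel_holds hX 2)).hodgeClasses
      (1 + 1) := by
    rw [hP₀, TensorProduct.range_mapIncl, Submodule.map₂_le]
    exact fun y hy z hz ↦ HodgeStructure.tmul_mem_hodgeClasses_tensor _ _ hy hz
  have htt : ∀ i, tt i ∈ ((hodge exists_isReal_hodgeModel_holds hX 2).tensor (hodge exists_isReal_hodgeModel_holds hX 2)).hodgeClasses
      (1 + 1) := by
    rw [show (1 : ℤ) + 1 = 2 by norm_num]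
    intro i
    fin_cases i
    · exact ht₀
    · exact ht₁
    · exact ht₂
    · exact ht₃
  have hQle : Q ≤ ((hodge exists_isReal_hodgeModel_holds hX 2).tensor (hodge exists_isReal_hodgeModel_holds hX 2)).hodgeClasses
      (1 + 1) := Submodule.span_le.2 (by rintro _ ⟨i, rfl⟩; exact htt i)
  have hPle : P₀ ⊔ Q ≤ ((hodge exists_isReal_hodgeModel_holds hX 2).tensor (hodge exists_isReal_hodgeModel_holds hX 2)).hodgeClasses
      (1 + 1) := sup_le hP₀le hQle
  -- the action `A s = (crossMap s ⊗ 1)_*` and the actions of the four correspondences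
  let A : bettiCohomology X 2 ⊗[ℚ] bettiCohomology X 2 → (complexBetti X 2 →ₗ[ℂ] complexBetti X 2) := fun s =>
    corrAction complexOrientationFamily hX hX (rfl : 2 + 2 * 2 = 2 + 2 * 2)
      (ofRatClass (ComplexPoints (X ⊗ X)) (2 * 2) (crossMap X X (show 2 + 2 = 2 * 2 by norm_num) s))
  have hAadd : ∀ s s', A (s + s') = A s + A s' := fun s s' => by simp only [A, map_add]
  have hAsmul : ∀ (q : ℚ) s, A (q • s) = (q : ℂ) • A s := fun q s => by simp only [A, map_smul, ofRatClass_rat_smul]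
  let σσ : Fin 4 → (X ⟶ X) := ![𝟙 X, τ, j, τ ≫ j]
  have hAtt : ∀ i, A (tt i) = (complexBetti.map (σσ i) 2).hom := by
    intro i
    fin_cases i
    · exact hact₀
    · exact hact₁
    · exact hact₂
    · exact hact₃
  -- MASTER RELATION: `p + Σ cᵢ tᵢ = 0` with `p ∈ NS ⊗ NS` forces `c = 0`
  have master : ∀ p ∈ P₀, ∀ c : Fin 4 → ℚ, p + ∑ i, c i • tt i = 0 → ∀ i, c i = 0 := by
    intro p hp c hrelc
    -- the action of the relation on `T ⊗ 1`
    have hy : ∀ x ∈ ψ.form.orthogonal ((hodge exists_isReal_hodgeModel_holds hX 2).hodgeClasses 1),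
        ∑ i, c i • pull (σσ i) 2 x = 0 := by
      intro x hx
      set y := ∑ i, c i • pull (σσ i) 2 x with hydef
      have hyT : y ∈ ψ.form.orthogonal ((hodge exists_isReal_hodgeModel_holds hX 2).hodgeClasses 1) :=
        Submodule.sum_mem _ fun i _ => Submodule.smul_mem _ _ (pull_mem_transcendental hX ψ (σσ i) hx)
      -- `y ⊗ 1 = -(A p)(x ⊗ 1) ∈ span_ℂ (NS ⊗ 1)`
      have hAp : A p (ofRatClass (ComplexPoints X) 2 x) ∈
          Submodule.span ℂ (ofRatClass (ComplexPoints X) 2 '' (NS : Set (bettiCohomology X 2))) :=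
        corrAction_ofRatClass_crossMap_mem_span_of_mem_range_mapIncl complexOrientationFamily
          hasPoincareDuality_complexOrientationFamily hX hX (show 2 + 2 = 2 * 2 by norm_num) (show 2 + 2 = 2 * 2 by norm_num)
          (rfl : 2 + 2 * 2 = 2 + 2 * 2) NS NS (by rw [hP₀] at hp; exact hp) _
      have hA0 : A 0 = 0 := by simp only [A, map_zero]
      have hAsum : ∀ c' : Fin 4 → ℚ, A (∑ i, c' i • tt i) = ∑ i, ((c' i : ℚ) : ℂ) • A (tt i) := fun c' => by
        simp only [Fin.sum_univ_four, hAadd, hAsmul]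
      have hsum : A p + ∑ i, ((c i : ℚ) : ℂ) • A (tt i) = 0 := by
        have h0 := congr_arg A hrelc
        rwa [hAadd, hAsum, hA0] at h0
      have happ := LinearMap.congr_fun hsum (ofRatClass (ComplexPoints X) 2 x)
      simp only [LinearMap.add_apply, LinearMap.zero_apply, LinearMap.sum_apply, LinearMap.smul_apply] at happ
      have hyc₀ : ofRatClass (ComplexPoints X) 2 y = ∑ i, ((c i : ℚ) : ℂ) • A (tt i) (ofRatClass (ComplexPoints X) 2 x) := by
        rw [hydef, map_sum]
        refine Finset.sum_congr rfl fun i _ => ?_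
        rw [ofRatClass_rat_smul, ofRatClass_pull, hAtt]
      have hyc : ofRatClass (ComplexPoints X) 2 y = -(A p (ofRatClass (ComplexPoints X) 2 x)) := by
        rw [hyc₀]
        exact eq_neg_of_add_eq_zero_right happ
      have hyNS : y ∈ NS := mem_of_ofRatClass_mem_span hX NS (by rw [hyc]; exact Submodule.neg_mem _ hAp)
      have : y ∈ NS ⊓ ψ.form.orthogonal ((hodge exists_isReal_hodgeModel_holds hX 2).hodgeClasses 1) :=
        Submodule.mem_inf.2 ⟨hyNS, hyT⟩
      rwa [hc.inf_eq_bot, Submodule.mem_bot] at this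
    -- quaternion independence on `T ≠ 0`
    have hq := quaternion_coeffs_eq_zero (ψ.form.orthogonal ((hodge exists_isReal_hodgeModel_holds hX 2).hodgeClasses 1)) hTne
      (pull τ 2) (pull j 2) (fun x hx => pull_mem_transcendental hX ψ τ hx) (fun x hx => pull_mem_transcendental hX ψ j hx)
      hτ2 hj2 hτj (c 0) (c 1) (c 2) (c 3) fun x hx => by
        have h := hy x hx
        simp only [Fin.sum_univ_four, σσ, Matrix.cons_val_zero, Matrix.cons_val_one, Matrix.head_cons,
          Matrix.cons_val_two, Matrix.tail_cons, Matrix.cons_val_three, pull_comp, LinearMap.comp_apply] at h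
        rwa [pull_id, LinearMap.id_apply] at h
    intro i
    fin_cases i
    · exact hq.1
    · exact hq.2.1
    · exact hq.2.2.1
    · exact hq.2.2.2
  -- dimension count: `dim (P₀ ⊔ Q) = ρ² + 4 = dim Hdg`
  haveI : Module.Free ℚ ↥NS := Module.Free.of_divisionRing ℚ _
  have hP₀rank : Module.finrank ℚ ↥P₀ = Module.finrank ℚ ↥NS * Module.finrank ℚ ↥NS := by
    rw [hP₀, LinearMap.finrank_range_of_inj (Module.Flat.tensorProduct_mapIncl_injective_of_right _ _), Module.finrank_tensorProduct]
  have hind : LinearIndependent ℚ tt := by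
    rw [Fintype.linearIndependent_iff]
    intro c hc0
    exact master 0 (Submodule.zero_mem _) c (by rw [zero_add]; exact hc0)
  have hQrank : Module.finrank ℚ ↥Q = 4 := by
    rw [hQ, finrank_span_eq_card hind, Fintype.card_fin]
  have hinf : P₀ ⊓ Q = ⊥ := by
    refine eq_bot_iff.2 fun x hx ↦ ?_
    obtain ⟨hx₀, hx₁⟩ := Submodule.mem_inf.1 hx
    rw [hQ] at hx₁
    obtain ⟨c, rfl⟩ := (Submodule.mem_span_range_iff_exists_fun ℚ).1 hx₁
    have hc0 := master (-(∑ i, c i • tt i)) (Submodule.neg_mem _ hx₀) c (neg_add_cancel _)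
    rw [Submodule.mem_bot]
    exact Finset.sum_eq_zero fun i _ => by rw [hc0 i, zero_smul]
  have hPrank : Module.finrank ℚ ↥(P₀ ⊔ Q) = Module.finrank ℚ ↥NS * Module.finrank ℚ ↥NS + 4 := by
    have e := Submodule.finrank_sup_add_finrank_inf_eq P₀ Q
    rw [hinf, finrank_bot, add_zero, hP₀rank, hQrank] at e
    exact e
  have hHrank : Module.finrank ℚ ↥(((hodge exists_isReal_hodgeModel_holds hX 2).tensor
      (hodge exists_isReal_hodgeModel_holds hX 2)).hodgeClasses (1 + 1)) =
      Module.finrank ℚ (Hom (hodge exists_isReal_hodgeModel_holds hX 2) (hodge exists_isReal_hodgeModel_holds hX 2)) := by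
    rw [show (1 : ℤ) + 1 = ((2 : ℕ) : ℤ) by norm_num]
    exact finrank_hodgeClasses_tensor_hodge_eq_finrank_hom exists_isReal_hodgeModel_holds hX hX 2
  have hPeq : P₀ ⊔ Q = ((hodge exists_isReal_hodgeModel_holds hX 2).tensor (hodge exists_isReal_hodgeModel_holds hX 2)).hodgeClasses
      (1 + 1) :=
    Submodule.eq_of_le_of_finrank_le hPle (by rw [hHrank, hPrank]; nlinarith [hEnd, sq (Module.finrank ℚ ↥NS)])
  -- conclusion: every Hodge class of `H²X ⊗ H²X` has algebraic cross product
  have ht' : t ∈ P₀ ⊔ Q := by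
    rw [hPeq, show (1 : ℤ) + 1 = 2 by norm_num]
    exact ht
  obtain ⟨p, hp, z, hz, rfl⟩ := Submodule.mem_sup.1 ht'
  rw [hQ] at hz
  obtain ⟨c, rfl⟩ := (Submodule.mem_span_range_iff_exists_fun ℚ).1 hz
  rw [map_add, map_add, map_sum, map_sum]
  refine Submodule.add_mem _ ?_ (Submodule.sum_mem _ fun i _ => ?_)
  · -- `p ∈ NS ⊗ NS`: products of divisor classes
    rw [hP₀] at hp
    obtain ⟨w, rfl⟩ := hp
    clear ht ht'
    induction w using TensorProduct.induction_on with
    | zero => rw [map_zero, map_zero, map_zero]; exact Submodule.zero_mem _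
    | tmul p q =>
      rw [TensorProduct.mapIncl, TensorProduct.map_tmul, Submodule.subtype_apply, Submodule.subtype_apply]
      have hpq := ofRatClass_crossMap_tmul_mem_algebraicClasses hX hX
        ((mem_hodgeClasses_hodge_two_iff_ofRatClass_mem_algebraicClasses_one exists_isReal_hodgeModel_holds hX _).1 p.2)
        ((mem_hodgeClasses_hodge_two_iff_ofRatClass_mem_algebraicClasses_one exists_isReal_hodgeModel_holds hX _).1 q.2)
      exact hpq
    | add x y hx hy => rw [map_add, map_add, map_add]; exact Submodule.add_mem _ hx hy
  · rw [map_smul, ofRatClass_rat_smul]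
    refine Submodule.smul_mem _ _ ?_
    fin_cases i
    · exact halg₀
    · exact halg₁
    · exact halg₂
    · exact halg₃

/-- **The square case of crux K2Q** — the conclusion of the registered stub `stub_squareQ` (`k ≤ 1`): for `X` with the route's
deck and `Comm` clauses, the Hodge conjecture holds for every limit fan on `k + 1 ≤ 2` copies of `X` (`k = 0`: Lefschetz
`(1,1)`; `k = 1`: `Y ≅ X ⊗ X` and `hodgeConjectureFor_tensor_self`). [cite: VoisinHodgeI2002, §11.3.3 Lemma 11.41]
[cite: Voisin2025, §3.2.1 Cor. 3.9] -/
theorem powersHodge_le_one (hX : IsSmoothProjective 2 X) (τ j : X ⟶ X) (h4 : pull τ 2 ^ 4 = 1)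
    (hj : pull j 2 ^ 2 = pull τ 2 ^ 2) (hrel : pull j 2 * pull τ 2 = pull τ 2 ^ 3 * pull j 2)
    (h20 : Module.finrank ℂ ↥(Module.End.eigenspace ((pull τ 2 ^ 2).baseChange ℂ) 1 ⊓
      (hodge exists_isReal_hodgeModel_holds hX 2).piece 2 0) = 0)
    (hpos : 0 < Module.finrank ℂ ↥(Module.End.eigenspace ((pull τ 2 ^ 2).baseChange ℂ) (-1) ⊓
      (hodge exists_isReal_hodgeModel_holds hX 2).piece 2 0))
    (hComm : haveI := finite hX 2; haveI : HodgeTensorFacts.{0, 0} := hodgeTensorFacts_holds;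
      ∀ g h : bettiCohomology X 2 ≃ₗ[ℚ] bettiCohomology X 2,
        ((∀ x, g (pull τ 2 x) = pull τ 2 (g x)) ∧ (∀ x, g (pull j 2 x) = pull j 2 (g x)) ∧
          (∀ x y, tr hX (2 + 2) (cup X 2 2 (g x) (g y)) = tr hX (2 + 2) (cup X 2 2 x y)) ∧
          ∀ x ∈ (hodge exists_isReal_hodgeModel_holds hX 2).hodgeClasses 1, g x = x) →
        ((∀ x, h (pull τ 2 x) = pull τ 2 (h x)) ∧ (∀ x, h (pull j 2 x) = pull j 2 (h x)) ∧
          (∀ x y, tr hX (2 + 2) (cup X 2 2 (h x) (h y)) = tr hX (2 + 2) (cup X 2 2 x y)) ∧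
          ∀ x ∈ (hodge exists_isReal_hodgeModel_holds hX 2).hodgeClasses 1, h x = x) →
        g * h * g⁻¹ * h⁻¹ ∈ (hodge exists_isReal_hodgeModel_holds hX 2).hodgeGroup)
    ⦃k : ℕ⦄ ⦃Y : SchemeOver ℂ⦄ (hk : k ≤ 1) (hY : ∃ π : Fin (k + 1) → (Y ⟶ X), Nonempty (IsLimit (Fan.mk Y π))) :
    HodgeConjectureFor (2 * (k + 1)) Y := by
  obtain ⟨π, ⟨hlim⟩⟩ := hY
  rcases Nat.le_one_iff_eq_zero_or_eq_one.1 hk with rfl | rfl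
  · exact (hodgeConjectureFor_iff_of_iso' (isoPowObj π hlim)).2 (hodgeConjectureFor_of_dim_le_three_holds (by norm_num) hX)
  · exact (hodgeConjectureFor_iff_of_iso' (isoPowObj π hlim)).2
      (hodgeConjectureFor_tensor_self hX τ j h4 hj hrel h20 hpos hComm)


/-! ### §4 The registered stub `stub_squareQ` of the K2Q birth skeleton, BY NAME -/

/-- **Registered stub `stub_squareQ`** of the birth skeleton of crux K2Q `PowersHodgeOfQuaternionCommutators`
(stmt-HodgeConjecture-24191; signature verbatim from `Cruxes/PowersHodgeOfQuaternionCommutators/Lines/birth.lean`),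
discharged by `powersHodge_le_one` (the engine binder `h₀` and `b₁(X) = 0` are not needed on this path).
[cite: VoisinHodgeI2002, §11.3.3 Lemma 11.41] [cite: Voisin2025, §3.2.1 Cor. 3.9] -/
theorem stub_squareQ :
    (∀ (K V : Type) [Field K] [CharZero K] [AddCommGroup V] [Module K V] (Q : LinearMap.BilinForm K V), (∀ x y, Q x y = Q y x) → Q.Nondegenerate → ∀ (a b : V →ₗ[K] V), (∀ x, a (a x) = -x) → (∀ x, b (b x) = -x) → (∀ x, a (b x) = -b (a x)) → (∀ x y, Q (a x) (a y) = Q x y) → (∀ x y, Q (b x) (b y) = Q x y) → ∀ (i : K), i * i = -1 → ∀ (c : LinearMap.BilinForm K V), (∀ g h : V ≃ₗ[K] V, (∀ x, g (a x) = a (g x)) → (∀ x, g (b x) = b (g x)) → (∀ x y, Q (g x) (g y) = Q x y) → (∀ x, h (a x) = a (h x)) → (∀ x, h (b x) = b (h x)) → (∀ x y, Q (h x) (h y) = Q x y) → ∀ x y, c ((g * h * g⁻¹ * h⁻¹) x) ((g * h * g⁻¹ * h⁻¹) y) = c x y) → ∃ α β γ δ : K, ∀ x y, c x y = α * Q x y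 + β * Q x (a y) + γ * Q x (b y) + δ * Q x (a (b y))) →
    open Literature.AlgebraicGeometry.Motives Literature.AlgebraicGeometry.HodgeTheory Literature.AlgebraicGeometry.HodgeTheory.BettiUniverse CategoryTheory.Limits in let Uni : (X : SchemeOver ℂ) → IsSmoothProjective 2 X → (X ⟶ X) → (X ⟶ X) → (bettiCohomology X 2 ≃ₗ[ℚ] bettiCohomology X 2) → Prop := fun X hX τ j g => (∀ x, g (pull τ 2 x) = pull τ 2 (g x)) ∧ (∀ x, g (pull j 2 x) = pull j 2 (g x)) ∧ (∀ x y, tr hX (2 + 2) (cup X 2 2 (g x) (g y)) = tr hX (2 + 2) (cup X 2 2 x y)) ∧ ∀ x ∈ (hodge exists_isReal_hodgeModel_holds hX 2).hodgeClasses 1, g x = x; let Comm : (X : SchemeOver ℂ) → IsSmoothProjective 2 X → (X ⟶ X) → (X ⟶ X) → Prop := fun X hX τ j => haveI := finite hX 2; haveI : HodgeTensorFacts.{0, 0} := hodgeTensorFacts_holds; ∀ g h : bettiCohomology X 2 ≃ₗ[ℚ] bettiCohomology X 2, Uni X hX τ j g → Uni X hX τ j h → g * h * g⁻¹ * h⁻¹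 ∈ (hodge exists_isReal_hodgeModel_holds hX 2).hodgeGroup; ∀ ⦃X : SchemeOver ℂ⦄ (hX : IsSmoothProjective 2 X), Module.finrank ℚ (bettiCohomology X 1) = 0 → ∀ τ j : X ⟶ X, (pull τ 2 ^ 4 = 1 ∧ pull j 2 ^ 2 = pull τ 2 ^ 2 ∧ pull j 2 * pull τ 2 = pull τ 2 ^ 3 * pull j 2 ∧ Module.finrank ℂ ↥(Module.End.eigenspace ((pull τ 2 ^ 2).baseChange ℂ) 1 ⊓ (hodge exists_isReal_hodgeModel_holds hX 2).piece 2 0) = 0 ∧ 0 < Module.finrank ℂ ↥(Module.End.eigenspace ((pull τ 2 ^ 2).baseChange ℂ) (-1) ⊓ (hodge exists_isReal_hodgeModel_holds hX 2).piece 2 0)) → Comm X hX τ j → ∀ ⦃k : ℕ⦄ ⦃Y : SchemeOver ℂ⦄, k ≤ 1 → (∃ π : Fin (k + 1) → (Y ⟶ X), Nonempty (IsLimit (Fan.mk Y π))) → HodgeConjectureFor (2 * (k + 1)) Y := by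
  intro _ Uni Comm X hX _ τ j hdeck hcomm k Y hk hY
  exact powersHodge_le_one hX τ j hdeck.1 hdeck.2.1 hdeck.2.2.1 hdeck.2.2.2.1 hdeck.2.2.2.2 hcomm hk hY

end Summit.HodgeConjecture.HodgeConjecture.Theorems.Q8SymplecticPowersSquare

end
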